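import Summits.KontsevichZagierPeriods.KontsevichZagierPeriods.Theorems.TerasomaMultiplicationBetaCancellationStubCatalystAlgebraicPoint
import Summits.KontsevichZagierPeriods.KontsevichZagierPeriods.Theorems.TerasomaMultiplicationBetaCancellationStubCatalyticNewtonLeibniz
import Summits.KontsevichZagierPeriods.KontsevichZagierPeriods.Theorems.TerasomaMultiplicationGammaHodgeSectorDefs

/-!
# `BetaCancellation` (stmt-KontsevichZagierPeriods-13633), line `dirichlet-companion-to-pi` — stub `stub_catalyticNewtonLeibnizDescent` (assembly, seat c14 cycle 2): CATALYTIC NEWTON–LEIBNIZ MOVES DESCEND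

**The sector.** Companion of `TerasomaMultiplicationBetaCancellationFibreSubstitution.lean` (fibre-form
substitutions). Seat c12 (I1) reduced a one-move certificate of `[p] ⋆ c ∈ KZ.relations` to ONE
two-term generator between pinned products `q = p ⊗ s`, `q' = p ⊗ s'`; the two-term generators of
the calculus are rule (2) (substitutions) and rule (3) (Newton–Leibniz). This file proves that a
Newton–Leibniz move between pinned products over an ARBITRARY catalyst `p : IntegralRep d` of
non-zero value descends to a Newton–Leibniz move between the bases:

* `stub_catalyticNewtonLeibnizDescent` — if `q = p ⊗ s` (band, dimension `d + n + 1`) and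
  `q' = p ⊗ s'` (base, dimension `d + n`) are related by ONE Newton–Leibniz move along the last
  coordinate (hypotheses verbatim those of `KZ.newtonLeibnizRel`), then `s ∼ s'`;
* `isPinned_catalyticNewtonLeibniz` — kernel vocabulary (`BetaCancellationNegative.IsPinned`);
* `betaCancellation_of_catalyticNewtonLeibniz` — **the crux's literal hypotheses at ALL positive
  rational exponents**, with `q ∼ q'` replaced by one explicit Newton–Leibniz move: `s ∼ s'`;
* `disc_catalyticNewtonLeibniz` — the disc `[π]` (item 0540's catalyst), convention `piRep.prod`.

**The mechanism.** A catalyst of non-zero value has a point `x₀` with algebraic (indeed rational)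
coordinates in its domain where `p.integrand x₀ ≠ 0` (`stub_catalyst_algebraicPoint`, p130847: the
non-vanishing set is `ℚ`-semialgebraic and not null, hence has interior). Slicing the fibrewise
primitive `F` at `x₀` and dividing by the algebraic constant `p.integrand x₀` gives a `ℚ`-semialgebraic
fibrewise primitive of `s.integrand` over `s'.domain` with the right boundary values; the band of `s`
over `s'.domain` is read off the big band at the points `Fin.append x₀ v`
(`stub_catalyticNewtonLeibniz`). No value is inverted inside the calculus except that algebraic
number. Together with the fibre-form substitutions this decides the ONE-MOVE form of the crux / of item
0540 except for a single rule-(2) move that does not map catalyst fibres into catalyst fibres (crux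
notes c14 K3). No definitions; sorry-free; axioms ⊆ {propext, Classical.choice, Quot.sound}.

References: M. Kontsevich, D. Zagier, *Periods* (2001), §1.2 rule (3); J. Ayoub, *Une version
relative de la conjecture des périodes de Kontsevich–Zagier*, Ann. of Math. 181 (2015), Rem. 1.3.
-/

noncomputable section

-- `Summit.KontsevichZagierPeriods.KontsevichZagierPeriods.…` is the tree's mandated layout (single-conjunct summit).
set_option linter.dupNamespace false

namespace Summit.KontsevichZagierPeriods.KontsevichZagierPeriods.BetaCancellationLine

open MeasureTheory Set
open Literature.NumberTheory.Transcendental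
open Literature.NumberTheory.Transcendental.KZ

/-! ### The assembly -/

/-- STUB (assembly, held by the lead, seat c14 cycle 2). **Catalytic Newton–Leibniz moves descend.**
For a catalyst `p : IntegralRep d` of NON-ZERO value, if the pinned products `q = p ⊗ s` (band, dimension
`d + n + 1`) and `q' = p ⊗ s'` (base, dimension `d + n`) — crux coordinates — are related by ONE
Newton–Leibniz move along the last coordinate (edges `a ≤ b`, fibrewise primitive `F`; hypotheses
verbatim those of `KZ.newtonLeibnizRel`), then `s ∼ s'`: slice the primitive at a catalyst point with
algebraic coordinates where `p.integrand ≠ 0` (`stub_catalyst_algebraicPoint`) and rescale by that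
algebraic constant (`stub_catalyticNewtonLeibniz`). [folklore] -/
theorem stub_catalyticNewtonLeibnizDescent {d n : ℕ} (p : IntegralRep d) (hp : p.value ≠ 0)
    (s : IntegralRep (n + 1)) (s' : IntegralRep n) (q : IntegralRep (d + n + 1))
    (q' : IntegralRep (d + n))
    (hq : q.domain = {z | (fun i => z (Fin.castAdd (n + 1) i)) ∈ p.domain ∧
      (fun j => z (Fin.natAdd d j)) ∈ s.domain})
    (hqi : Set.EqOn q.integrand (fun z => p.integrand (fun i => z (Fin.castAdd (n + 1) i)) *
      s.integrand (fun j => z (Fin.natAdd d j))) q.domain)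
    (hq' : q'.domain = {z | (fun i => z (Fin.castAdd n i)) ∈ p.domain ∧
      (fun j => z (Fin.natAdd d j)) ∈ s'.domain})
    (hq'i : Set.EqOn q'.integrand (fun z => p.integrand (fun i => z (Fin.castAdd n i)) *
      s'.integrand (fun j => z (Fin.natAdd d j))) q'.domain)
    (a b : (Fin (d + n) → ℝ) → ℝ) (F : (Fin (d + n + 1) → ℝ) → ℝ)
    (hF : IsSemialgebraicFunOn ℚ q.domain F)
    (ha : IsSemialgebraicFunOn ℚ q'.domain a) (hb : IsSemialgebraicFunOn ℚ q'.domain b)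
    (hab : ∀ x ∈ q'.domain, a x ≤ b x)
    (hdom : q.domain = {z | (Fin.init z : Fin (d + n) → ℝ) ∈ q'.domain ∧
      a (Fin.init z) ≤ z (Fin.last (d + n)) ∧ z (Fin.last (d + n)) ≤ b (Fin.init z)})
    (hcont : ∀ x ∈ q'.domain, ContinuousOn (fun t : ℝ => F (Fin.snoc x t)) (Set.Icc (a x) (b x)))
    (hderiv : ∀ x ∈ q'.domain, ∀ t ∈ Set.Ioo (a x) (b x),
      HasDerivAt (fun u : ℝ => F (Fin.snoc x u)) (q.integrand (Fin.snoc x t)) t)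
    (hval : ∀ x ∈ q'.domain, q'.integrand x = F (Fin.snoc x (b x)) - F (Fin.snoc x (a x))) :
    Equivalent s s' := by
  obtain ⟨x₀, hx₀, halg, hpx₀⟩ := stub_catalyst_algebraicPoint p hp
  exact stub_catalyticNewtonLeibniz p x₀ hx₀ halg hpx₀ s s' q q' hq hqi hq' hq'i a b F hF ha hb hab
    hdom hcont hderiv hval

/-! ### Corollaries in the crux's vocabularies: kernels on `(0,1)`, the Beta kernel, the disc -/

section Corollaries

open Summit.KontsevichZagierPeriods.KontsevichZagierPeriods.BetaCancellationNegative
  (IsPinned pinDomain pinFun betaKernel)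
open Summit.KontsevichZagierPeriods.GammaHodgeSectorKO (betaRep betaRep_value_pos)
open Literature.NumberTheory.Transcendental.KZreg (unitIoo)

/-- **Kernel form.** For ANY kernel representation `κ` on `(0,1)` of non-zero value: if the band
`q` is pinned over `s` and the base `q'` over `s'` with kernel `k` (`BetaCancellationNegative.IsPinned`)
and `[q] − [q']` is ONE Newton–Leibniz move, then `s ∼ s'`. [folklore] -/
theorem isPinned_catalyticNewtonLeibniz {n : ℕ} {k : ℝ → ℝ} (κ : IntegralRep 1)
    (hκd : κ.domain = unitIoo) (hκi : EqOn κ.integrand (fun x => k (x 0)) κ.domain)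
    (hκ0 : κ.value ≠ 0) (s : IntegralRep (n + 1)) (s' : IntegralRep n) (q : IntegralRep (1 + n + 1))
    (q' : IntegralRep (1 + n)) (hq : IsPinned k s q) (hq' : IsPinned k s' q')
    (a b : (Fin (1 + n) → ℝ) → ℝ) (F : (Fin (1 + n + 1) → ℝ) → ℝ)
    (hF : IsSemialgebraicFunOn ℚ q.domain F)
    (ha : IsSemialgebraicFunOn ℚ q'.domain a) (hb : IsSemialgebraicFunOn ℚ q'.domain b)
    (hab : ∀ x ∈ q'.domain, a x ≤ b x)
    (hdom : q.domain = {z | (Fin.init z : Fin (1 + n) → ℝ) ∈ q'.domain ∧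
      a (Fin.init z) ≤ z (Fin.last (1 + n)) ∧ z (Fin.last (1 + n)) ≤ b (Fin.init z)})
    (hcont : ∀ x ∈ q'.domain, ContinuousOn (fun t : ℝ => F (Fin.snoc x t)) (Set.Icc (a x) (b x)))
    (hderiv : ∀ x ∈ q'.domain, ∀ t ∈ Set.Ioo (a x) (b x),
      HasDerivAt (fun u : ℝ => F (Fin.snoc x u)) (q.integrand (Fin.snoc x t)) t)
    (hval : ∀ x ∈ q'.domain, q'.integrand x = F (Fin.snoc x (b x)) - F (Fin.snoc x (a x))) :
    Equivalent s s' := by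
  have hdom' : ∀ (m : ℕ) (σ : Set (Fin m → ℝ)), pinDomain σ =
      {z : Fin (1 + m) → ℝ | (fun i => z (Fin.castAdd m i)) ∈ κ.domain ∧
        (fun j => z (Fin.natAdd 1 j)) ∈ σ} := by
    intro m σ
    ext z
    simp only [pinDomain, mem_setOf_eq, mem_Ioo, hκd, KZreg.unitIoo]
  have hint : ∀ (m : ℕ) (t : IntegralRep m) (u : IntegralRep (1 + m)), IsPinned k t u →
      EqOn u.integrand (fun z => κ.integrand (fun i => z (Fin.castAdd m i)) *
        t.integrand (fun j => z (Fin.natAdd 1 j))) u.domain := by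
    intro m t u hu z hz
    rw [hu.2 hz]
    have hz0 : (fun i => z (Fin.castAdd m i)) ∈ κ.domain := by
      have := hz
      rw [hu.1, hdom'] at this
      exact this.1
    simp only [pinFun, hκi hz0]
  exact stub_catalyticNewtonLeibnizDescent κ hκ0 s s' q q' (hq.1.trans (hdom' _ _)) (hint _ s q hq)
    (hq'.1.trans (hdom' _ _)) (hint _ s' q' hq') a b F hF ha hb hab hdom hcont hderiv hval

/-- **The crux's Newton–Leibniz sector at ALL exponents (seat c14).** `BetaCancellation` with its
hypothesis `q ∼ q'` replaced by ONE explicit Newton–Leibniz move from the band `q` (pinned over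
`s : IntegralRep (n+1)`) onto the base `q'` (pinned over `s'`), everything else verbatim: then
`s ∼ s'`. The Beta value `B(a,b) ≠ 0` is never inverted inside the calculus — only the algebraic
number `t₀^(a-1)(1-t₀)^(b-1)` at an algebraic slice point `t₀`. [folklore] -/
theorem betaCancellation_of_catalyticNewtonLeibniz (a₀ b₀ : ℚ) (ha₀ : 0 < a₀) (hb₀ : 0 < b₀)
    {n : ℕ} (s : IntegralRep (n + 1)) (s' : IntegralRep n) (q : IntegralRep (1 + n + 1))
    (q' : IntegralRep (1 + n))
    (hq : q.domain = {z | z (Fin.castAdd (n + 1) 0) ∈ Set.Ioo (0:ℝ) 1 ∧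
      (fun j => z (Fin.natAdd 1 j)) ∈ s.domain})
    (hqi : Set.EqOn q.integrand (fun z => (z (Fin.castAdd (n + 1) 0)) ^ ((a₀:ℝ) - 1) *
      (1 - z (Fin.castAdd (n + 1) 0)) ^ ((b₀:ℝ) - 1) * s.integrand (fun j => z (Fin.natAdd 1 j)))
      q.domain)
    (hq' : q'.domain = {z | z (Fin.castAdd n 0) ∈ Set.Ioo (0:ℝ) 1 ∧
      (fun j => z (Fin.natAdd 1 j)) ∈ s'.domain})
    (hq'i : Set.EqOn q'.integrand (fun z => (z (Fin.castAdd n 0)) ^ ((a₀:ℝ) - 1) *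
      (1 - z (Fin.castAdd n 0)) ^ ((b₀:ℝ) - 1) * s'.integrand (fun j => z (Fin.natAdd 1 j)))
      q'.domain)
    (a b : (Fin (1 + n) → ℝ) → ℝ) (F : (Fin (1 + n + 1) → ℝ) → ℝ)
    (hF : IsSemialgebraicFunOn ℚ q.domain F)
    (ha : IsSemialgebraicFunOn ℚ q'.domain a) (hb : IsSemialgebraicFunOn ℚ q'.domain b)
    (hab : ∀ x ∈ q'.domain, a x ≤ b x)
    (hdom : q.domain = {z | (Fin.init z : Fin (1 + n) → ℝ) ∈ q'.domain ∧
      a (Fin.init z) ≤ z (Fin.last (1 + n)) ∧ z (Fin.last (1 + n)) ≤ b (Fin.init z)})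
    (hcont : ∀ x ∈ q'.domain, ContinuousOn (fun t : ℝ => F (Fin.snoc x t)) (Set.Icc (a x) (b x)))
    (hderiv : ∀ x ∈ q'.domain, ∀ t ∈ Set.Ioo (a x) (b x),
      HasDerivAt (fun u : ℝ => F (Fin.snoc x u)) (q.integrand (Fin.snoc x t)) t)
    (hval : ∀ x ∈ q'.domain, q'.integrand x = F (Fin.snoc x (b x)) - F (Fin.snoc x (a x))) :
    Equivalent s s' :=
  isPinned_catalyticNewtonLeibniz (k := betaKernel a₀ b₀) (betaRep a₀ b₀ ha₀ hb₀) rfl (fun _ _ => rfl)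
    (betaRep_value_pos a₀ b₀ ha₀ hb₀).ne' s s' q q' ⟨hq, hqi⟩ ⟨hq', hq'i⟩ a b F hF ha hb hab hdom hcont
    hderiv hval

/-- **The disc (item 0540's catalyst), closed-term convention `piRep.prod`.** If the band
`q = [π] ⊗ s` and the base `q' = [π] ⊗ s'` are related by ONE Newton–Leibniz move, then `s ∼ s'`
(slice at a rational point of the disc). [folklore] -/
theorem disc_catalyticNewtonLeibniz {n : ℕ} (s : IntegralRep (n + 1)) (s' : IntegralRep n)
    (q : IntegralRep (2 + n + 1)) (q' : IntegralRep (2 + n))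
    (hq : q.domain = {z | (fun i => z (Fin.castAdd (n + 1) i)) ∈ piDisc ∧
      (fun j => z (Fin.natAdd 2 j)) ∈ s.domain})
    (hqi : Set.EqOn q.integrand (fun z => s.integrand (fun j => z (Fin.natAdd 2 j))) q.domain)
    (hq' : q'.domain = {z | (fun i => z (Fin.castAdd n i)) ∈ piDisc ∧
      (fun j => z (Fin.natAdd 2 j)) ∈ s'.domain})
    (hq'i : Set.EqOn q'.integrand (fun z => s'.integrand (fun j => z (Fin.natAdd 2 j))) q'.domain)
    (a b : (Fin (2 + n) → ℝ) → ℝ) (F : (Fin (2 + n + 1) → ℝ) → ℝ)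
    (hF : IsSemialgebraicFunOn ℚ q.domain F)
    (ha : IsSemialgebraicFunOn ℚ q'.domain a) (hb : IsSemialgebraicFunOn ℚ q'.domain b)
    (hab : ∀ x ∈ q'.domain, a x ≤ b x)
    (hdom : q.domain = {z | (Fin.init z : Fin (2 + n) → ℝ) ∈ q'.domain ∧
      a (Fin.init z) ≤ z (Fin.last (2 + n)) ∧ z (Fin.last (2 + n)) ≤ b (Fin.init z)})
    (hcont : ∀ x ∈ q'.domain, ContinuousOn (fun t : ℝ => F (Fin.snoc x t)) (Set.Icc (a x) (b x)))
    (hderiv : ∀ x ∈ q'.domain, ∀ t ∈ Set.Ioo (a x) (b x),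
      HasDerivAt (fun u : ℝ => F (Fin.snoc x u)) (q.integrand (Fin.snoc x t)) t)
    (hval : ∀ x ∈ q'.domain, q'.integrand x = F (Fin.snoc x (b x)) - F (Fin.snoc x (a x))) :
    Equivalent s s' :=
  stub_catalyticNewtonLeibnizDescent piRep (by rw [piRep_value]; exact Real.pi_ne_zero) s s' q q' hq
    (fun z hz => by rw [hqi hz]; simp) hq' (fun z hz => by rw [hq'i hz]; simp) a b F hF ha hb hab
    hdom hcont hderiv hval

end Corollaries

end Summit.KontsevichZagierPeriods.KontsevichZagierPeriods.BetaCancellationLine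

end
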